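import Mathlib.GroupTheory.SpecificGroups.Quaternion
import Summits.MatrixMultiplication.OmegaCensus.Quaternion16NoTPP112
import Summits.MatrixMultiplication.OmegaCensus.DicyclicLift
import Summits.MatrixMultiplication.OmegaCensus.DihedralLikeLawGap12
import HarnessLib

/-!
# `β(Q₁₆) = 16`: the last dicyclic window closes (kernel)

ω-census, family (b3).  Framing: lottery ticket; floor = certified bounds/negative ranges.

`DicyclicLift.dicyclic_window` left `16 ≤ β(Q₁₆) ≤ 20` (`Q₁₆ = QuaternionGroup 4 = G(ℤ₈, 4)`, `|A| = 8`, too small for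
the general dicyclic law theorems); the census value `16` was an exhaustive-search datum.  **Here it becomes a theorem**
(`quaternion16_law`), so `β(Q_{4n}) = 8⌊2n/3⌋` now holds for every `n ≥ 3` (`dicyclic_law_complete` had to exclude `n = 4`).

**Proof.** Vertex counting at `N = 8` (`vertex_fc8`, 2 694 evaluations by `decide`): a volume in `[17, 20]` is `20` with
two dominoes and a five-element third set, or `18` with one domino and two sets of coset parts `{1,2}`.  The first is
impossible in every dicyclic-type group (`two_domino_odd_bound`: saturating the odd set by the central involution
`ρ(c₀)` (tree `tpp_saturate`) gives a TPP triple of volume `4(|U|+1)`, so `12(|U|+1) ≤ 8|A|`; here `72 ≤ 64`).  The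
second is a finite check in `Q₁₆` itself (`q16_no_tpp_112_fc`: after right translations, `S = {1, xa s}`,
`T = {1, xa t, xa t'}`, `U = {1, xa u, xa u'}`; all `8·28·28` cases fail the TPP, `decide`).
-/

namespace Summit.MatrixMultiplication.OmegaCensus

open Literature.Combinatorics.Additive Finset

/-! ## Arithmetic at `N = 8` -/

/-- Finite check at `N = 8`: volumes `17 … 20` compatible with the eight vertex constraints have shape
`(1,1 | 1,1 | 5)` (volume 20, two dominoes) or `(1,1 | {1,2} | {1,2})` (volume 18), up to roles. [folklore] -/
theorem vertex_fc8 :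
    ((List.range 20).all fun S' =>
      (List.range (20 / (S' + 1))).all fun T' =>
      (List.range (20 / ((S' + 1) * (T' + 1)) - 16 / ((S' + 1) * (T' + 1)))).all fun U'' =>
      (List.range (S' + 2)).all fun s₀ => (List.range (T' + 2)).all fun t₀ =>
      (List.range (U'' + 16 / ((S' + 1) * (T' + 1)) + 2)).all fun u₀ =>
        decide (
          let s₁ := S' + 1 - s₀
          let t₁ := T' + 1 - t₀
          let u₁ := U'' + 16 / ((S' + 1) * (T' + 1)) + 1 - u₀
          s₁ * t₀ * u₀ + s₀ * t₁ * u₀ + s₀ * t₀ * u₁ ≤ 8 → s₀ * t₁ * u₁ + s₁ * t₀ * u₁ + s₁ * t₁ * u₀ ≤ 8 →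
          s₀ * t₀ * u₀ + s₁ * t₁ * u₀ + s₁ * t₀ * u₁ ≤ 8 → s₁ * t₁ * u₁ + s₀ * t₀ * u₁ + s₀ * t₁ * u₀ ≤ 8 →
          s₁ * t₁ * u₀ + s₀ * t₀ * u₀ + s₀ * t₁ * u₁ ≤ 8 → s₀ * t₀ * u₁ + s₁ * t₁ * u₁ + s₁ * t₀ * u₀ ≤ 8 →
          s₁ * t₀ * u₁ + s₀ * t₁ * u₁ + s₀ * t₀ * u₀ ≤ 8 → s₀ * t₁ * u₀ + s₁ * t₀ * u₀ + s₁ * t₁ * u₁ ≤ 8 →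
          ((s₀ + s₁) * (t₀ + t₁) * (u₀ + u₁) = 20 ∧
            ((s₀ = 1 ∧ s₁ = 1 ∧ t₀ = 1 ∧ t₁ = 1 ∧ u₀ + u₁ = 5) ∨ (s₀ = 1 ∧ s₁ = 1 ∧ u₀ = 1 ∧ u₁ = 1 ∧ t₀ + t₁ = 5) ∨
             (t₀ = 1 ∧ t₁ = 1 ∧ u₀ = 1 ∧ u₁ = 1 ∧ s₀ + s₁ = 5))) ∨
          ((s₀ + s₁) * (t₀ + t₁) * (u₀ + u₁) = 18 ∧
            ((s₀ = 1 ∧ s₁ = 1 ∧ ((t₀ = 1 ∧ t₁ = 2) ∨ (t₀ = 2 ∧ t₁ = 1)) ∧ ((u₀ = 1 ∧ u₁ = 2) ∨ (u₀ = 2 ∧ u₁ = 1))) ∨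
             (t₀ = 1 ∧ t₁ = 1 ∧ ((s₀ = 1 ∧ s₁ = 2) ∨ (s₀ = 2 ∧ s₁ = 1)) ∧ ((u₀ = 1 ∧ u₁ = 2) ∨ (u₀ = 2 ∧ u₁ = 1))) ∨
             (u₀ = 1 ∧ u₁ = 1 ∧ ((s₀ = 1 ∧ s₁ = 2) ∨ (s₀ = 2 ∧ s₁ = 1)) ∧ ((t₀ = 1 ∧ t₁ = 2) ∨ (t₀ = 2 ∧ t₁ = 1))))))) =
      true := by
  decide

/-- The arithmetic at `N = 8` for actual parts. [folklore] -/
theorem shape8_of_vertex_bounds (s₀ s₁ t₀ t₁ u₀ u₁ : ℕ)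
    (h000 : s₁ * t₀ * u₀ + s₀ * t₁ * u₀ + s₀ * t₀ * u₁ ≤ 8) (h111 : s₀ * t₁ * u₁ + s₁ * t₀ * u₁ + s₁ * t₁ * u₀ ≤ 8)
    (h100 : s₀ * t₀ * u₀ + s₁ * t₁ * u₀ + s₁ * t₀ * u₁ ≤ 8) (h011 : s₁ * t₁ * u₁ + s₀ * t₀ * u₁ + s₀ * t₁ * u₀ ≤ 8)
    (h010 : s₁ * t₁ * u₀ + s₀ * t₀ * u₀ + s₀ * t₁ * u₁ ≤ 8) (h101 : s₀ * t₀ * u₁ + s₁ * t₁ * u₁ + s₁ * t₀ * u₀ ≤ 8)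
    (h001 : s₁ * t₀ * u₁ + s₀ * t₁ * u₁ + s₀ * t₀ * u₀ ≤ 8) (h110 : s₀ * t₁ * u₀ + s₁ * t₀ * u₀ + s₁ * t₁ * u₁ ≤ 8)
    (hlo : 17 ≤ (s₀ + s₁) * (t₀ + t₁) * (u₀ + u₁)) (hhi : (s₀ + s₁) * (t₀ + t₁) * (u₀ + u₁) ≤ 20) :
    ((s₀ + s₁) * (t₀ + t₁) * (u₀ + u₁) = 20 ∧
      ((s₀ = 1 ∧ s₁ = 1 ∧ t₀ = 1 ∧ t₁ = 1 ∧ u₀ + u₁ = 5) ∨ (s₀ = 1 ∧ s₁ = 1 ∧ u₀ = 1 ∧ u₁ = 1 ∧ t₀ + t₁ = 5) ∨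
       (t₀ = 1 ∧ t₁ = 1 ∧ u₀ = 1 ∧ u₁ = 1 ∧ s₀ + s₁ = 5))) ∨
    ((s₀ + s₁) * (t₀ + t₁) * (u₀ + u₁) = 18 ∧
      ((s₀ = 1 ∧ s₁ = 1 ∧ ((t₀ = 1 ∧ t₁ = 2) ∨ (t₀ = 2 ∧ t₁ = 1)) ∧ ((u₀ = 1 ∧ u₁ = 2) ∨ (u₀ = 2 ∧ u₁ = 1))) ∨
       (t₀ = 1 ∧ t₁ = 1 ∧ ((s₀ = 1 ∧ s₁ = 2) ∨ (s₀ = 2 ∧ s₁ = 1)) ∧ ((u₀ = 1 ∧ u₁ = 2) ∨ (u₀ = 2 ∧ u₁ = 1))) ∨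
       (u₀ = 1 ∧ u₁ = 1 ∧ ((s₀ = 1 ∧ s₁ = 2) ∨ (s₀ = 2 ∧ s₁ = 1)) ∧ ((t₀ = 1 ∧ t₁ = 2) ∨ (t₀ = 2 ∧ t₁ = 1))))) := by
  set S := s₀ + s₁ with hS
  set T := t₀ + t₁ with hT
  set U := u₀ + u₁ with hU
  have hS1 : 1 ≤ S := Nat.pos_of_ne_zero (by rintro h0; rw [h0, zero_mul, zero_mul] at hlo; omega)
  have hT1 : 1 ≤ T := Nat.pos_of_ne_zero (by rintro h0; rw [h0, mul_zero, zero_mul] at hlo; omega)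
  have hU1 : 1 ≤ U := Nat.pos_of_ne_zero (by rintro h0; rw [h0, mul_zero] at hlo; omega)
  have hST : S * T ≤ 20 := le_trans (Nat.le_mul_of_pos_right _ hU1) hhi
  have hSle : S ≤ 20 := le_trans (Nat.le_mul_of_pos_right _ hT1) hST
  have iS : S - 1 < 20 := by omega
  have iT : T - 1 < 20 / (S - 1 + 1) := by
    rw [Nat.sub_add_cancel hS1]
    have : T ≤ 20 / S := (Nat.le_div_iff_mul_le hS1).2 (by rw [mul_comm]; exact hST)
    omega
  have hq2 : U ≤ 20 / (S * T) := (Nat.le_div_iff_mul_le (by positivity)).2 (by rw [mul_comm]; exact hhi)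
  have hq1 : 16 / (S * T) < U := (Nat.div_lt_iff_lt_mul (by positivity)).2 (by rw [mul_comm]; omega)
  have iU : U - (16 / ((S - 1 + 1) * (T - 1 + 1)) + 1) <
      20 / ((S - 1 + 1) * (T - 1 + 1)) - 16 / ((S - 1 + 1) * (T - 1 + 1)) := by
    rw [Nat.sub_add_cancel hS1, Nat.sub_add_cancel hT1]; omega
  have is₀ : s₀ < S - 1 + 2 := by omega
  have it₀ : t₀ < T - 1 + 2 := by omega
  have iu₀ : u₀ < U - (16 / ((S - 1 + 1) * (T - 1 + 1)) + 1) + 16 / ((S - 1 + 1) * (T - 1 + 1)) + 2 := by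
    rw [Nat.sub_add_cancel hS1, Nat.sub_add_cancel hT1]; omega
  have key := vertex_fc8
  simp only [List.all_eq_true, List.mem_range, decide_eq_true_iff] at key
  have k := key (S - 1) iS (T - 1) iT (U - (16 / ((S - 1 + 1) * (T - 1 + 1)) + 1)) iU s₀ is₀ t₀ it₀ u₀ iu₀
  have e1 : S - 1 + 1 - s₀ = s₁ := by omega
  have e2 : T - 1 + 1 - t₀ = t₁ := by omega
  have e3 : U - (16 / ((S - 1 + 1) * (T - 1 + 1)) + 1) + 16 / ((S - 1 + 1) * (T - 1 + 1)) + 1 - u₀ = u₁ := by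
    rw [Nat.sub_add_cancel hS1, Nat.sub_add_cancel hT1]; omega
  simp only [e1, e2, e3] at k
  exact k h000 h111 h100 h011 h010 h101 h001 h110

/-! ## Two dominoes and an odd set in dicyclic type -/

section DihedralLike

variable {A : Type*} [AddCommGroup A] [DecidableEq A] [Fintype A] {G : Type} [Group G] [DecidableEq G]
  {ρ τ : A → G} {c₀ : A} {S T U : Finset G}

/-- **Saturation bound.** Dicyclic type (`c₀ ≠ 0`); if `S`, `T` are dominoes (one element in each coset) and `|U|` is
odd, then `(S, T, U ∪ Uρ(c₀))` is a TPP triple of volume `4(|U|+1)`, so `12(|U| + 1) ≤ 8|A|`. [folklore] -/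
theorem two_domino_odd_bound
    (hρρ : ∀ a b, ρ a * ρ b = ρ (a + b)) (hρτ : ∀ a b, ρ a * τ b = τ (b - a))
    (hτρ : ∀ a b, τ a * ρ b = τ (a + b)) (hττ : ∀ a b, τ a * τ b = ρ (c₀ + b - a)) (hc₀ : c₀ ≠ 0)
    (hρ : Function.Injective ρ) (hτ : Function.Injective τ) (hne : ∀ a b, ρ a ≠ τ b)
    (hsurj : ∀ g, (∃ a, ρ a = g) ∨ (∃ a, τ a = g)) (h : TripleProductProperty S T U)
    (hs₀ : (univ.filter fun a : A => ρ a ∈ S).card = 1) (hs₁ : (univ.filter fun a : A => τ a ∈ S).card = 1)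
    (ht₀ : (univ.filter fun a : A => ρ a ∈ T).card = 1) (ht₁ : (univ.filter fun a : A => τ a ∈ T).card = 1)
    (hodd : ¬ 2 ∣ U.card) : 3 * (2 * 2 * (U.card + 1)) ≤ 8 * Fintype.card A := by
  set z : G := ρ c₀ with hz
  have h2c := two_c0_eq_zero hρτ hτρ hττ hτ
  have hzc : ∀ g, Commute z g := commute_rho_c0 hρρ hρτ hτρ hττ hτ hsurj
  have hzz : z * z = 1 := rho_c0_mul_self hρρ hρτ hτρ hττ hτ
  have hsat := tpp_saturate hzc hzz (domino_quot_stable hρρ hρτ hτρ hττ hτ hne hsurj hs₀ hs₁)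
    (domino_quot_stable hρρ hρτ hτρ hττ hτ hne hsurj ht₀ ht₁) h
  have hle := three_volume_le_of_vertex_counting hρρ hρτ hτρ hττ hρ hτ hne hsurj hsat
  have cS : S.card = 2 := by rw [card_eq_parts' hρ hτ hne hsurj S, hs₀, hs₁]
  have cT : T.card = 2 := by rw [card_eq_parts' hρ hτ hne hsurj T, ht₀, ht₁]
  rw [cS, cT] at hle
  have hgrow : ¬ (U ∪ U.image (· * z)).card ≤ U.card := by
    intro hUU
    have hsub : U.image (· * z) ⊆ U := fun x hx =>
      (eq_of_subset_of_card_le subset_union_left hUU).symm ▸ mem_union_right _ hx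
    have memz : ∀ x ∈ U, x * z ∈ U := fun x hx => hsub (mem_image_of_mem _ hx)
    have hper₀ : (univ.filter fun a : A => ρ a ∈ U).image (· + c₀) = (univ.filter fun a : A => ρ a ∈ U) := by
      apply eq_of_subset_of_card_le _ (by rw [card_image_of_injective _ (add_left_injective c₀)])
      intro x hx
      obtain ⟨a, ha, rfl⟩ := mem_image.1 hx
      refine mem_filter.2 ⟨mem_univ _, ?_⟩
      have := memz _ (mem_filter.1 ha).2
      rwa [hz, hρρ] at this
    have hper₁ : (univ.filter fun a : A => τ a ∈ U).image (· + c₀) = (univ.filter fun a : A => τ a ∈ U) := by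
      apply eq_of_subset_of_card_le _ (by rw [card_image_of_injective _ (add_left_injective c₀)])
      intro x hx
      obtain ⟨a, ha, rfl⟩ := mem_image.1 hx
      refine mem_filter.2 ⟨mem_univ _, ?_⟩
      have := memz _ (mem_filter.1 ha).2
      rwa [hz, hτρ] at this
    obtain ⟨k₀, hk₀⟩ := card_even_of_periodic hper₀ hc₀ h2c
    obtain ⟨k₁, hk₁⟩ := card_even_of_periodic hper₁ hc₀ h2c
    have cU := card_eq_parts' hρ hτ hne hsurj U
    rw [hk₀, hk₁] at cU
    exact hodd ⟨k₀ + k₁, by rw [cU]; ring⟩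
  omega

end DihedralLike

/-! ## The finite check in `Q₁₆` and the assembly -/

section Q16

/-- Right translation by `a(−c)` of a set with `ρ`-part `{c}` and `τ`-part `P`: it becomes `{1} ∪ xa(P − c)`;
here for a domino. [folklore] -/
theorem q16_map_domino {S : Finset (QuaternionGroup 4)} {c s : ZMod 8}
    (hSa : ∀ i, QuaternionGroup.a i ∈ S ↔ i = c) (hSx : ∀ i, QuaternionGroup.xa i ∈ S ↔ i = s) :
    S.map (Equiv.mulRight (QuaternionGroup.a (-c))).toEmbedding =
      ({QuaternionGroup.a 0, QuaternionGroup.xa (s - c)} : Finset (QuaternionGroup 4)) := by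
  ext g
  simp only [Finset.mem_map, Equiv.toEmbedding_apply, Equiv.coe_mulRight, mem_insert, mem_singleton]
  constructor
  · rintro ⟨x, hx, rfl⟩
    cases x with
    | a i => left; rw [(hSa i).1 hx, QuaternionGroup.a_mul_a, add_neg_cancel]
    | xa i => right; rw [(hSx i).1 hx, QuaternionGroup.xa_mul_a, sub_eq_add_neg]
  · rintro (rfl | rfl)
    · exact ⟨QuaternionGroup.a c, (hSa c).2 rfl, by rw [QuaternionGroup.a_mul_a, add_neg_cancel]⟩
    · exact ⟨QuaternionGroup.xa s, (hSx s).2 rfl, by rw [QuaternionGroup.xa_mul_a, sub_eq_add_neg]⟩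

/-- The same for a set with `ρ`-part `{c}` and `τ`-part `{p, q}`. [folklore] -/
theorem q16_map_three {S : Finset (QuaternionGroup 4)} {c p q : ZMod 8}
    (hSa : ∀ i, QuaternionGroup.a i ∈ S ↔ i = c) (hSx : ∀ i, QuaternionGroup.xa i ∈ S ↔ i = p ∨ i = q) :
    S.map (Equiv.mulRight (QuaternionGroup.a (-c))).toEmbedding =
      ({QuaternionGroup.a 0, QuaternionGroup.xa (p - c), QuaternionGroup.xa (q - c)} : Finset (QuaternionGroup 4)) := by
  ext g
  simp only [Finset.mem_map, Equiv.toEmbedding_apply, Equiv.coe_mulRight, mem_insert, mem_singleton]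
  constructor
  · rintro ⟨x, hx, rfl⟩
    cases x with
    | a i => left; rw [(hSa i).1 hx, QuaternionGroup.a_mul_a, add_neg_cancel]
    | xa i =>
      right
      rcases (hSx i).1 hx with rfl | rfl
      · left; rw [QuaternionGroup.xa_mul_a, sub_eq_add_neg]
      · right; rw [QuaternionGroup.xa_mul_a, sub_eq_add_neg]
  · rintro (rfl | rfl | rfl)
    · exact ⟨QuaternionGroup.a c, (hSa c).2 rfl, by rw [QuaternionGroup.a_mul_a, add_neg_cancel]⟩
    · exact ⟨QuaternionGroup.xa p, (hSx p).2 (Or.inl rfl), by rw [QuaternionGroup.xa_mul_a, sub_eq_add_neg]⟩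
    · exact ⟨QuaternionGroup.xa q, (hSx q).2 (Or.inr rfl), by rw [QuaternionGroup.xa_mul_a, sub_eq_add_neg]⟩

/-- No TPP triple of `Q₁₆` with coset parts exactly `(1,1 | 1,2 | 1,2)` (`ρ = a`, `τ = xa`). [folklore] -/
theorem q16_no_tpp_112 {S T U : Finset (QuaternionGroup 4)} (h : TripleProductProperty S T U)
    (hs₀ : (univ.filter fun i : ZMod 8 => QuaternionGroup.a i ∈ S).card = 1)
    (hs₁ : (univ.filter fun i : ZMod 8 => QuaternionGroup.xa i ∈ S).card = 1)
    (ht₀ : (univ.filter fun i : ZMod 8 => QuaternionGroup.a i ∈ T).card = 1)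
    (ht₁ : (univ.filter fun i : ZMod 8 => QuaternionGroup.xa i ∈ T).card = 2)
    (hu₀ : (univ.filter fun i : ZMod 8 => QuaternionGroup.a i ∈ U).card = 1)
    (hu₁ : (univ.filter fun i : ZMod 8 => QuaternionGroup.xa i ∈ U).card = 2) : False := by
  obtain ⟨a₀, hS₀⟩ := card_eq_one.1 hs₀
  obtain ⟨s₀, hS₁⟩ := card_eq_one.1 hs₁
  obtain ⟨a₁, hT₀⟩ := card_eq_one.1 ht₀
  obtain ⟨t, t', htt, hT₁⟩ := card_eq_two.1 ht₁
  obtain ⟨a₂, hU₀⟩ := card_eq_one.1 hu₀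
  obtain ⟨u, u', huu, hU₁⟩ := card_eq_two.1 hu₁
  have mSa : ∀ i, QuaternionGroup.a i ∈ S ↔ i = a₀ := fun i => by simpa using Finset.ext_iff.1 hS₀ i
  have mSx : ∀ i, QuaternionGroup.xa i ∈ S ↔ i = s₀ := fun i => by simpa using Finset.ext_iff.1 hS₁ i
  have mTa : ∀ i, QuaternionGroup.a i ∈ T ↔ i = a₁ := fun i => by simpa using Finset.ext_iff.1 hT₀ i
  have mTx : ∀ i, QuaternionGroup.xa i ∈ T ↔ i = t ∨ i = t' := fun i => by simpa using Finset.ext_iff.1 hT₁ i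
  have mUa : ∀ i, QuaternionGroup.a i ∈ U ↔ i = a₂ := fun i => by simpa using Finset.ext_iff.1 hU₀ i
  have mUx : ∀ i, QuaternionGroup.xa i ∈ U ↔ i = u ∨ i = u' := fun i => by simpa using Finset.ext_iff.1 hU₁ i
  have h' := h.map_mulRight (QuaternionGroup.a (-a₀)) (QuaternionGroup.a (-a₁)) (QuaternionGroup.a (-a₂))
  rw [q16_map_domino mSa mSx, q16_map_three mTa mTx, q16_map_three mUa mUx] at h'
  -- order the two `xa`-indices of `T` and of `U`
  have keyT : ∀ {p q : ZMod 8} {V : Finset (QuaternionGroup 4)}, p ≠ q →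
      TripleProductProperty ({QuaternionGroup.a 0, QuaternionGroup.xa (s₀ - a₀)} : Finset (QuaternionGroup 4))
        ({QuaternionGroup.a 0, QuaternionGroup.xa p, QuaternionGroup.xa q} : Finset (QuaternionGroup 4)) V →
      ∃ p' q' : ZMod 8, p'.val < q'.val ∧
        TripleProductProperty ({QuaternionGroup.a 0, QuaternionGroup.xa (s₀ - a₀)} : Finset (QuaternionGroup 4))
          ({QuaternionGroup.a 0, QuaternionGroup.xa p', QuaternionGroup.xa q'} : Finset (QuaternionGroup 4)) V := by
    intro p q V hpq hV
    rcases Nat.lt_or_gt_of_ne (fun hv => hpq (ZMod.val_injective 8 hv)) with hlt | hlt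
    · exact ⟨p, q, hlt, hV⟩
    · refine ⟨q, p, hlt, ?_⟩
      have e : ({QuaternionGroup.a 0, QuaternionGroup.xa p, QuaternionGroup.xa q} : Finset (QuaternionGroup 4)) =
          {QuaternionGroup.a 0, QuaternionGroup.xa q, QuaternionGroup.xa p} :=
        congrArg (insert (QuaternionGroup.a 0)) (Finset.pair_comm _ _)
      rw [e] at hV; exact hV
  obtain ⟨p', q', hpq', h''⟩ := keyT (V := _) (sub_left_injective.ne htt) h'
  -- order `U` by reversing the roles `(S,T,U) ↦ (U,T,S)` twice
  have hU' := tpp_reverse h''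
  rcases Nat.lt_or_gt_of_ne (fun hv => (sub_left_injective.ne huu) (ZMod.val_injective 8 hv)) with hlt | hlt
  · exact q16_no_tpp_112_fc _ _ _ _ _ hpq' hlt (tpp_reverse hU')
  · have e : ({QuaternionGroup.a 0, QuaternionGroup.xa (u - a₂), QuaternionGroup.xa (u' - a₂)} :
        Finset (QuaternionGroup 4)) = {QuaternionGroup.a 0, QuaternionGroup.xa (u' - a₂), QuaternionGroup.xa (u - a₂)} :=
      congrArg (insert (QuaternionGroup.a 0)) (Finset.pair_comm _ _)
    rw [e] at hU'
    exact q16_no_tpp_112_fc _ _ _ _ _ hpq' hlt (tpp_reverse hU')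

/-- No TPP triple of `Q₁₆` with a domino `S` and coset parts `{1,2}` (either orientation) for `T` and `U`: the orientations
are normalised by right translation by `xa 0`. [folklore] -/
theorem q16_no_tpp_18 {S T U : Finset (QuaternionGroup 4)} (h : TripleProductProperty S T U)
    (hs₀ : (univ.filter fun i : ZMod 8 => QuaternionGroup.a i ∈ S).card = 1)
    (hs₁ : (univ.filter fun i : ZMod 8 => QuaternionGroup.xa i ∈ S).card = 1)
    (hT : ((univ.filter fun i : ZMod 8 => QuaternionGroup.a i ∈ T).card = 1 ∧
            (univ.filter fun i : ZMod 8 => QuaternionGroup.xa i ∈ T).card = 2) ∨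
          ((univ.filter fun i : ZMod 8 => QuaternionGroup.a i ∈ T).card = 2 ∧
            (univ.filter fun i : ZMod 8 => QuaternionGroup.xa i ∈ T).card = 1))
    (hU : ((univ.filter fun i : ZMod 8 => QuaternionGroup.a i ∈ U).card = 1 ∧
            (univ.filter fun i : ZMod 8 => QuaternionGroup.xa i ∈ U).card = 2) ∨
          ((univ.filter fun i : ZMod 8 => QuaternionGroup.a i ∈ U).card = 2 ∧
            (univ.filter fun i : ZMod 8 => QuaternionGroup.xa i ∈ U).card = 1)) : False := by
  have hρρ : ∀ i j : ZMod (2 * 4), QuaternionGroup.a i * QuaternionGroup.a j = QuaternionGroup.a (i + j) :=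
    QuaternionGroup.a_mul_a
  have hρτ : ∀ i j : ZMod (2 * 4), QuaternionGroup.a i * QuaternionGroup.xa j = QuaternionGroup.xa (j - i) :=
    QuaternionGroup.a_mul_xa
  have hττ : ∀ i j : ZMod (2 * 4), QuaternionGroup.xa i * QuaternionGroup.xa j =
      QuaternionGroup.a (((4 : ℕ) : ZMod (2 * 4)) + j - i) := QuaternionGroup.xa_mul_xa
  have er : (Equiv.mulRight (1 : QuaternionGroup 4)).toEmbedding = Function.Embedding.refl _ := by ext x; simp
  have cρ := card_rho_part_mulRight_tau hρρ hρτ hττ (A := ZMod (2 * 4))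
  have cτ := card_tau_part_mulRight_tau hρρ hττ (A := ZMod (2 * 4))
  rcases hT with ⟨ht₀, ht₁⟩ | ⟨ht₀, ht₁⟩ <;> rcases hU with ⟨hu₀, hu₁⟩ | ⟨hu₀, hu₁⟩
  · exact q16_no_tpp_112 h hs₀ hs₁ ht₀ ht₁ hu₀ hu₁
  · have h1 := h.map_mulRight 1 1 (QuaternionGroup.xa 0)
    simp only [er, Finset.map_refl] at h1
    exact q16_no_tpp_112 h1 hs₀ hs₁ ht₀ ht₁ (by rw [cρ, hu₁]) (by rw [cτ, hu₀])
  · have h1 := h.map_mulRight 1 (QuaternionGroup.xa 0) 1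
    simp only [er, Finset.map_refl] at h1
    exact q16_no_tpp_112 h1 hs₀ hs₁ (by rw [cρ, ht₁]) (by rw [cτ, ht₀]) hu₀ hu₁
  · have h1 := h.map_mulRight 1 (QuaternionGroup.xa 0) (QuaternionGroup.xa 0)
    simp only [er, Finset.map_refl] at h1
    exact q16_no_tpp_112 h1 hs₀ hs₁ (by rw [cρ, ht₁]) (by rw [cτ, ht₀]) (by rw [cρ, hu₁]) (by rw [cτ, hu₀])

/-- **`β(Q₁₆) = 16`** (both halves kernel): every TPP triple of `QuaternionGroup 4` has `|S||T||U| ≤ 16`, and `16` is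
attained (`quaternion_volume_ge_law`).  Closes `dicyclic_window`; with `dicyclic_law_complete`, `β(Q_{4n}) = 8⌊2n/3⌋` for
every `n ≥ 3`. [folklore] -/
theorem quaternion16_law :
    (∀ S T U : Finset (QuaternionGroup 4), TripleProductProperty S T U → S.card * T.card * U.card ≤ 16) ∧
    ∃ S T U : Finset (QuaternionGroup 4), TripleProductProperty S T U ∧ S.card * T.card * U.card = 16 := by
  refine ⟨fun S T U h => ?_, by simpa using quaternion_volume_ge_law (n := 4) (by norm_num)⟩
  have h20 : S.card * T.card * U.card ≤ 20 := by have := tpp_volume_le_law_quaternion (n := 4) h; omega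
  by_contra hgt
  have hlo : 17 ≤ S.card * T.card * U.card := by omega
  -- the dihedral-like presentation of `Q₁₆ = G(ℤ₈, 4)`
  have hρρ : ∀ i j : ZMod (2 * 4), QuaternionGroup.a i * QuaternionGroup.a j = QuaternionGroup.a (i + j) :=
    QuaternionGroup.a_mul_a
  have hρτ : ∀ i j : ZMod (2 * 4), QuaternionGroup.a i * QuaternionGroup.xa j = QuaternionGroup.xa (j - i) :=
    QuaternionGroup.a_mul_xa
  have hτρ : ∀ i j : ZMod (2 * 4), QuaternionGroup.xa i * QuaternionGroup.a j = QuaternionGroup.xa (i + j) :=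
    QuaternionGroup.xa_mul_a
  have hττ : ∀ i j : ZMod (2 * 4), QuaternionGroup.xa i * QuaternionGroup.xa j =
      QuaternionGroup.a (((4 : ℕ) : ZMod (2 * 4)) + j - i) := QuaternionGroup.xa_mul_xa
  have hρ : Function.Injective (QuaternionGroup.a : ZMod (2 * 4) → QuaternionGroup 4) := fun i j hij => by
    cases hij; rfl
  have hτ : Function.Injective (QuaternionGroup.xa : ZMod (2 * 4) → QuaternionGroup 4) := fun i j hij => by
    cases hij; rfl
  have hne : ∀ i j : ZMod (2 * 4), QuaternionGroup.a i ≠ QuaternionGroup.xa j := fun i j hij => by cases hij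
  have hsurj : ∀ g : QuaternionGroup 4, (∃ i, QuaternionGroup.a i = g) ∨ (∃ i, QuaternionGroup.xa i = g) := fun g => by
    cases g with
    | a i => exact Or.inl ⟨i, rfl⟩
    | xa i => exact Or.inr ⟨i, rfl⟩
  have hc₀ : (((4 : ℕ) : ZMod (2 * 4)) : ZMod (2 * 4)) ≠ 0 := by decide
  have hcard : Fintype.card (ZMod (2 * 4)) = 8 := ZMod.card _
  obtain ⟨h000, h111, h100, h011, h010, h101, h001, h110⟩ := vertex_counting' hρρ hρτ hτρ hττ hρ hτ hne h
  rw [hcard] at h000 h111 h100 h011 h010 h101 h001 h110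
  have cS := card_eq_parts' hρ hτ hne hsurj S
  have cT := card_eq_parts' hρ hτ hne hsurj T
  have cU := card_eq_parts' hρ hτ hne hsurj U
  set s₀ := (univ.filter fun i : ZMod (2 * 4) => QuaternionGroup.a i ∈ S).card with hs₀
  set s₁ := (univ.filter fun i : ZMod (2 * 4) => QuaternionGroup.xa i ∈ S).card with hs₁
  set t₀ := (univ.filter fun i : ZMod (2 * 4) => QuaternionGroup.a i ∈ T).card with ht₀
  set t₁ := (univ.filter fun i : ZMod (2 * 4) => QuaternionGroup.xa i ∈ T).card with ht₁
  set u₀ := (univ.filter fun i : ZMod (2 * 4) => QuaternionGroup.a i ∈ U).card with hu₀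
  set u₁ := (univ.filter fun i : ZMod (2 * 4) => QuaternionGroup.xa i ∈ U).card with hu₁
  rw [cS, cT, cU] at hlo h20
  have hV_TUS : T.card * U.card * S.card = S.card * T.card * U.card := by ring
  have hV_UST : U.card * S.card * T.card = S.card * T.card * U.card := by ring
  rcases shape8_of_vertex_bounds s₀ s₁ t₀ t₁ u₀ u₁ h000 h111 h100 h011 h010 h101 h001 h110 hlo h20 with
    ⟨h20', hsh⟩ | ⟨-, hsh⟩
  · -- volume 20: two dominoes and a five-element set — saturation
    rcases hsh with ⟨e1, e2, e3, e4, e5⟩ | ⟨e1, e2, e3, e4, e5⟩ | ⟨e1, e2, e3, e4, e5⟩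
    · have := two_domino_odd_bound hρρ hρτ hτρ hττ hc₀ hρ hτ hne hsurj h e1 e2 e3 e4 (by rw [cU]; omega)
      rw [hcard, cU] at this; omega
    · have := two_domino_odd_bound hρρ hρτ hτρ hττ hc₀ hρ hτ hne hsurj (tpp_reverse h.rotate) e1 e2 e3 e4
        (by rw [cT]; omega)
      rw [hcard, cT] at this; omega
    · have := two_domino_odd_bound hρρ hρτ hτρ hττ hc₀ hρ hτ hne hsurj h.rotate e1 e2 e3 e4 (by rw [cS]; omega)
      rw [hcard, cS] at this; omega
  · -- volume 18: the finite check
    rcases hsh with ⟨e1, e2, hT', hU'⟩ | ⟨e1, e2, hS', hU'⟩ | ⟨e1, e2, hS', hT'⟩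
    · exact q16_no_tpp_18 h e1 e2 hT' hU'
    · exact q16_no_tpp_18 h.rotate e1 e2 hU' hS'
    · exact q16_no_tpp_18 h.rotate.rotate e1 e2 hS' hT'

end Q16


section AllN

variable {n : ℕ} [NeZero n]

/-- **`β(Q_{4n}) = 8⌊2n/3⌋` for EVERY `n ≥ 3`** — `dicyclic_law_complete` (`n ≠ 4`) together with `quaternion16_law`
(`n = 4`): the dicyclic / generalized quaternion family is completely settled in the kernel. [folklore] -/
theorem dicyclic_law_all (hn : 3 ≤ n) :
    (∀ S T U : Finset (QuaternionGroup n), TripleProductProperty S T U →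
        S.card * T.card * U.card ≤ 8 * (2 * n / 3)) ∧
    ∃ S T U : Finset (QuaternionGroup n), TripleProductProperty S T U ∧ S.card * T.card * U.card = 8 * (2 * n / 3) := by
  by_cases h4 : n = 4
  · subst h4
    refine ⟨fun S T U h => ?_, ?_⟩
    · have := quaternion16_law.1 S T U h; omega
    · obtain ⟨S, T, U, h, hV⟩ := quaternion16_law.2
      exact ⟨S, T, U, h, by omega⟩
  · exact dicyclic_law_complete hn h4

end AllN

end Summit.MatrixMultiplication.OmegaCensus
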